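import Summits.Ventures.YMGap.RobustBall.LoopActionMember
import Summits.Ventures.YMGap.RobustBall.RectangleEdges
import Literature.MathematicalPhysics.QuantumFieldTheory.Z2WilsonLoopGKSUpper
import HarnessLib

/-!
# Venture YMGap, track ROBUST-BALL (tier 2) — ALL SELF-AVOIDING LOOPS AT ONCE: the family of closed trails has
# finite carrier fibres, so the loop-action norm ball over it is inside the weighted ball

HONEST FRAMING. WHAT THIS IS: a venture file (cell `pub-ymgap`, track Y2 ROBUST-BALL, seat rb-p1) discharging the
only structural side condition of `memBallZdS_loopFamilyAction` (`LoopActionMember.lean`) for the largest natural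
loop family: `trailLoop`, the inclusion of ALL nontrivial closed TRAILS of `ℤ^d` (closed lattice walks traversing
no link twice — every self-avoiding polygon, every shape, every size, every base point). A closed trail with edge
set `X` has length `|X|` (tree `card_walkEdges_of_isTrail`) and is based at an endpoint of a link of `X`, so each
carrier fibre is finite (`finite_fibre_trailLoop`, via Mathlib's `finsetWalkLength` on the locally finite graph
`zdGraph d`); plus the generic DIAMETER FORM of the norm (`loopNormLE_of_diam`: `∑_{i ∋ e} |c_i| |γ_i| e^{w D_i} ≤ ε`
suffices, `D_i` an `ℓ^∞`-diameter bound of `γ_i`). CONSEQUENCE (`perturbedMassGapAtS_trailFamily` and cells): for EVERY coupling function `c` on the set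
of all nontrivial closed trails with weighted norm `‖c‖_w ≤ ε`, the generic Wilson-type action
`S_Wilson + ∑_γ c_γ Re tr U_γ / N` has the mass gap given by the tier-2 row `MassGapOnBallZdS d N β (2ε) ε w` —
`SU(2)`, `d = 4`, `β_W = 1/16`: `ε = 0.143` at weight `2^{dist}`; every `N ≥ 2` at 't Hooft `1/64`: `ε = 1/40` at
weight `(6/5)^{dist}`. WHAT IT IS NOT: strong-coupling lattice statements inside the rows' windows; nothing about the
continuum limit or the Clay problem.

References: the norm ball and rows are this track's (`LoopActionMember.lean`); trails and walk counting are
Mathlib's (`SimpleGraph.Walk.IsTrail`, `SimpleGraph.finsetWalkLength`). [folklore]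
-/

noncomputable section

open Function SimpleGraph Real
open Literature.Probability.LatticeModels
open Literature.MathematicalPhysics.QuantumLattice
open Literature.MathematicalPhysics.QuantumFieldTheory (walkEdges card_walkEdges_of_isTrail)
open Summit.QuantumFields.BalabanUV.InfraRed.StrongCouplingPoincareDoorSUN (OneLinkPoincareSUN)
open Summit.QuantumFields.BalabanUV.InfraRed.StrongCouplingVarianceDoorSUN (OneLinkVarianceBound)

namespace Summit.Ventures.YMGap.RobustBall

variable {d N : ℕ}

/-! ### The base point of a nontrivial walk is an endpoint of its first link -/

section Base

/-- A nontrivial walk starts at an endpoint of one of its links: `x = e.1` or `x = e.1 + e_{e.2}` for some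
`e ∈ walkEdges w`. -/
theorem exists_mem_walkEdges_base {x y : Site d} :
    ∀ (w : (zdGraph d).Walk x y), 0 < w.length → ∃ e ∈ walkEdges w, x = e.1 ∨ x = e.1 + Pi.single e.2 1
  | .nil, h => by simp at h
  | .cons (v := v) hadj p, _ => by
    set a : (zdGraph d).Dart := ⟨(x, v), hadj⟩ with ha
    refine ⟨(dartStep a).1, by rw [walkEdges_cons]; exact Finset.mem_insert_self _ _, ?_⟩
    rcases dartDir_spec a with h | h
    · have hs : dartStep a = ((a.fst, dartDir a), true) := by
        unfold dartStep; rw [if_pos h]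
      exact Or.inl (by rw [hs])
    · have hne : ¬ a.snd = a.fst + Pi.single (dartDir a) 1 := fun h' => not_snd_eq_and_fst_eq _ _ _ h' h
      have hs : dartStep a = ((a.snd, dartDir a), false) := by
        unfold dartStep; rw [if_neg hne]
      exact Or.inr (by rw [hs]; exact h)

end Base

/-! ### The family of all nontrivial closed trails and its finite fibres -/

section Family

variable (d) in
/-- Index of the family of ALL nontrivial closed trails of `ℤ^d`: closed lattice loops of positive length
traversing no link twice (Mathlib `Walk.IsTrail`). -/
abbrev TrailIdx : Type := {γ : ZdLoop d // γ.walk.IsTrail ∧ 0 < γ.walk.length}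

/-- **The trail family**: the inclusion of all nontrivial closed trails among closed loops. -/
def trailLoop (i : TrailIdx d) : ZdLoop d := i.1

/-- The trail family is injective. -/
theorem trailLoop_injective : Injective (trailLoop (d := d)) := Subtype.val_injective

/-- Closed loops with base point in a finite set and prescribed length form a finite set (the nearest-neighbour
graph of `ℤ^d` is locally finite; Mathlib `finsetWalkLength`). -/
theorem finite_loops_of_base_mem_of_length (S : Finset (Site d)) (n : ℕ) :
    {γ : ZdLoop d | γ.base ∈ S ∧ γ.walk.length = n}.Finite := by
  classical
  refine (Set.finite_range (fun p : (Σ x : S, ((zdGraph d).finsetWalkLength n (x : Site d) x : Set ((zdGraph d).Walk x x))) =>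
    (⟨p.1, p.2⟩ : ZdLoop d))).subset ?_
  rintro ⟨x, w⟩ ⟨hx, hlen⟩
  exact ⟨⟨⟨x, hx⟩, ⟨w, by rw [Finset.mem_coe, mem_finsetWalkLength_iff]; exact hlen⟩⟩, rfl⟩

/-- **The carrier fibres of the trail family are finite**: a closed trail with edge set `X` has length `|X|` and
is based at an endpoint of a link of `X`. -/
theorem finite_fibre_trailLoop (X : Finset (ZdEdge d)) :
    {i : TrailIdx d | walkEdges (trailLoop i).walk = X}.Finite := by
  classical
  set S : Finset (Site d) := X.image Prod.fst ∪ X.image (fun e => e.1 + Pi.single e.2 1) with hS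
  have hT := finite_loops_of_base_mem_of_length S X.card
  refine ((hT.preimage trailLoop_injective.injOn)).subset ?_
  rintro ⟨γ, htr, hlen⟩ hX
  change walkEdges γ.walk = X at hX
  refine ⟨?_, ?_⟩
  · obtain ⟨e, he, hbase⟩ := exists_mem_walkEdges_base γ.walk hlen
    rw [hX] at he
    change γ.base ∈ S
    rcases hbase with h | h
    · exact Finset.mem_union_left _ (Finset.mem_image.2 ⟨e, he, h.symm⟩)
    · exact Finset.mem_union_right _ (Finset.mem_image.2 ⟨e, he, h.symm⟩)
  · change γ.walk.length = X.card
    rw [← hX, card_walkEdges_of_isTrail htr]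

end Family

/-! ### The norm in diameter form (generic families) -/

section Diam

variable {ι : Type*} {w ε : ℝ} {γ : ι → ZdLoop d} {c : ι → ℝ} {D : ι → ℝ}

/-- **Diameter form of the weight**: if the links of `γ_i` are pairwise within `ℓ^∞`-distance `D_i`, then through any
of its links the term `i` weighs at most `|c_i| · |γ_i| · e^{w D_i}` (`w ≥ 0`; `∑_y mult_i(y) = |γ_i|`). -/
theorem loopWeightAt_le_of_diam (hw : 0 ≤ w)
    (hD : ∀ i, ∀ e ∈ walkEdges (γ i).walk, ∀ y ∈ walkEdges (γ i).walk, ‖e.1 - y.1‖ ≤ D i) (e : ZdEdge d) (i : ι) :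
    loopWeightAt w γ c e i ≤
      if e ∈ walkEdges (γ i).walk then |c i| * (γ i).walk.length * exp (w * D i) else 0 := by
  unfold loopWeightAt
  split_ifs with he
  · rw [mul_assoc]
    refine mul_le_mul_of_nonneg_left ?_ (abs_nonneg _)
    calc ∑ y ∈ walkEdges (γ i).walk, (dartMult (γ i).walk y : ℝ) * exp (w * ‖e.1 - y.1‖)
        ≤ ∑ y ∈ walkEdges (γ i).walk, (dartMult (γ i).walk y : ℝ) * exp (w * D i) :=
          Finset.sum_le_sum fun y hy => mul_le_mul_of_nonneg_left
            (exp_le_exp.2 (mul_le_mul_of_nonneg_left (hD i e he y hy) hw)) (Nat.cast_nonneg _)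
      _ = ((γ i).walk.length : ℝ) * exp (w * D i) := by
          rw [← Finset.sum_mul, ← Nat.cast_sum, sum_walkEdges_dartMult]
  · exact le_rfl

/-- **The norm ball in diameter form**: `sup_e ∑_{i : e ∈ γ_i} |c_i| · |γ_i| · e^{w·D_i} ≤ ε` (with `D_i` an `ℓ^∞`
diameter bound of the carrier of `γ_i`, `w, ε ≥ 0`) implies `‖c‖_w ≤ ε` — the directive's "weights growing with the
diameter/support of the interaction term". -/
theorem loopNormLE_of_diam (hw : 0 ≤ w) (hε : 0 ≤ ε)
    (hD : ∀ i, ∀ e ∈ walkEdges (γ i).walk, ∀ y ∈ walkEdges (γ i).walk, ‖e.1 - y.1‖ ≤ D i)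
    (hs : ∀ e : ZdEdge d, Summable fun i =>
      if e ∈ walkEdges (γ i).walk then |c i| * (γ i).walk.length * exp (w * D i) else 0)
    (hle : ∀ e : ZdEdge d,
      ∑' i, (if e ∈ walkEdges (γ i).walk then |c i| * (γ i).walk.length * exp (w * D i) else 0) ≤ ε) :
    LoopNormLE w γ c ε := by
  have hdom := fun e => loopWeightAt_le_of_diam (c := c) hw hD e
  exact ⟨hε, fun e => (hs e).of_nonneg_of_le (loopWeightAt_nonneg w γ c e) (hdom e), fun e =>
    (Summable.tsum_le_tsum (hdom e) ((hs e).of_nonneg_of_le (loopWeightAt_nonneg w γ c e) (hdom e)) (hs e)).trans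
      (hle e)⟩

end Diam

/-! ### Membership and mass gap for arbitrary couplings on all closed trails -/

section Member

variable {w ε : ℝ} {c : TrailIdx d → ℝ}

/-- **All closed trails at once**: a coupling function on the nontrivial closed trails of norm `‖c‖_w ≤ ε` gives a
member `loopFamilyAction N trailLoop c ∈ MemBallZdS (2ε) ε w`. -/
theorem memBallZdS_trailFamily (h : LoopNormLE w trailLoop c ε) :
    MemBallZdS (2 * ε) ε w (loopFamilyAction (d := d) N trailLoop c) :=
  memBallZdS_loopFamilyAction finite_fibre_trailLoop h

/-- **Mass gap for every coupling function on all closed trails inside the norm ball**, from any tier-2 row. -/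
theorem perturbedMassGapAtS_trailFamily {β : ℝ} (hrow : MassGapOnBallZdS d N β (2 * ε) ε w)
    (h : LoopNormLE w trailLoop c ε) : PerturbedMassGapAtS d N β (loopFamilyAction (d := d) N trailLoop c) :=
  perturbedMassGapAtS_loopFamilyAction hrow finite_fibre_trailLoop h

/-- Every term of the trail-family action is gauge invariant. -/
theorem isZdGaugeInvariant_trailFamily (c : TrailIdx d → ℝ) (X : Finset (ZdEdge d)) :
    IsZdGaugeInvariant (loopFamilyAction (d := d) N trailLoop c X) :=
  isZdGaugeInvariant_loopFamilyAction trailLoop c X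

end Member

/-! ### Cells -/

section Rows

variable {c : TrailIdx 4 → ℝ}

/-- **`SU(2)`, `d = 4`, `β_W = 1/16` — every coupling function on ALL closed trails with `‖c‖_{log 2} ≤ 0.143`**:
`∑_{γ ∋ e} |c_γ| ∑_{y ∈ γ} 2^{‖e−y‖_∞} ≤ 0.143` through every link `e` (a trail has all multiplicities `1`) ⇒ unique
DLR state and exponential clustering (cell `su2_loopFamily_massGapS_1_16`). -/
theorem su2_allTrails_massGapS_1_16 (h : LoopNormLE (Real.log 2) trailLoop c (143 / 1000)) :
    PerturbedMassGapAtS 4 2 ((1 / 16 : ℝ) / 4) (loopFamilyAction (d := 4) 2 trailLoop c) :=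
  su2_loopFamily_massGapS_1_16 finite_fibre_trailLoop h

/-- **`SU(2)`, `d = 4`, `β_W = 1/20`**: radius `0.209` at weight `2^{dist}`. -/
theorem su2_allTrails_massGapS_1_20 (h : LoopNormLE (Real.log 2) trailLoop c (209 / 1000)) :
    PerturbedMassGapAtS 4 2 ((1 / 20 : ℝ) / 4) (loopFamilyAction (d := 4) 2 trailLoop c) :=
  su2_loopFamily_massGapS_1_20 finite_fibre_trailLoop h

/-- **Every `N ≥ 2`, `d = 4`, 't Hooft `1/64`**: radius `1/40` at weight `(6/5)^{dist}`, `N`-uniform. -/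
theorem suN_allTrails_massGapS_1_64 {N : ℕ} (hN : 2 ≤ N) (h : LoopNormLE (Real.log (6 / 5)) trailLoop c (1 / 40)) :
    PerturbedMassGapAtS 4 N (1 / 64) (loopFamilyAction (d := 4) N trailLoop c) :=
  suN_loopFamily_massGapS_1_64 hN finite_fibre_trailLoop h

/-- **`SU(3)`, `d = 4`, `β_W = 1/8`, given the two certified one-link constants**: radius `0.116` at `2^{dist}`. -/
theorem su3_allTrails_massGapS_1_8 (hP : OneLinkPoincareSUN 3 (3 / 5) (4 / 5))
    (hV : OneLinkVarianceBound 3 (11 / 30) (49 / 20)) (h : LoopNormLE (Real.log 2) trailLoop c (29 / 250)) :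
    PerturbedMassGapAtS 4 3 ((1 / 8 : ℝ) / 9) (loopFamilyAction (d := 4) 3 trailLoop c) :=
  su3_loopFamily_massGapS_1_8 hP hV finite_fibre_trailLoop h

end Rows

end Summit.Ventures.YMGap.RobustBall

end
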